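import Literature.NumberTheory.Automorphic.BaseChangeStrongCuspidalPrimeToDegreeProofs
import Literature.NumberTheory.Automorphic.BaseChangeStrongCuspidalPrimeProofs
import HarnessLib

/-!
# `ACStrongCuspidalBaseChangePrime` (stmt-Langlands-15022): the item is Arthur–Clozel's strong
# cuspidal base change in prime degree; ranks `n ≤ 1` settled, `ℓ ∤ n` from the tree's leaves

Route `Langlands/IrreducibilityBySelfDuality`, support item r8 (child 3/4 of the re-route of the crux
`GaloisRepOfRegularAlgebraic`, hypothesis `hBC` of `GaloisRepOfRegularAlgebraic.of_leaves_of_weilTraces`).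
The item's text is VERBATIM the right-hand side of
`Literature.NumberTheory.Automorphic.ArthurClozel1989_strongLifting_cuspidal_iff` (Arthur–Clozel,
Ann. of Math. Stud. 120 (1989), Ch. 3, Thm. 4.2 (a) with Thm. 5.1: for `E/F` Galois of prime degree
and `π` cuspidal on `GL_n(𝔸_F)` unramified at some finite place ramified in `E`, a CUSPIDAL `P` on
`GL_n(𝔸_E)` with `t_{P,w} = t_{π,v}^{f(w|v)}` at every finite `w ∣ v` over a place unramified in `E`)
— an XL named fact (twisted trace formula).  Like its siblings for this crux, this module does NOT
import the Theses file (cycle hazard) and states the item's text structurally.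

What is recorded here (all sorry-free, axioms `propext`/`Classical.choice`/`Quot.sound`):

* `of_strongLifting` / `strongLifting_of` — **the item IS the named fact** (both directions are the
  identity map): it closes the day `ArthurClozel1989_strongLifting_cuspidal_holds` lands, and not before.
* `rank_le_one` — **the item's conclusion for `n ≤ 1`, UNCONDITIONALLY** (tree theorem
  `ArthurClozel1989_strongLifting_cuspidal.of_le_one`: in rank one all three leaves below are
  theorems — `χ ↦ χ ∘ N_{E/F}`, strong multiplicity one for `GL₁`, rigidity of Hecke characters).
* `of_not_dvd` — **for `ℓ = [E:F] ∤ n` the item's conclusion holds for EVERY cuspidal `π`**, granted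
  in rank `n` the three standard Arthur–Clozel leaves of the tree: Thm. 4.2 (a) in `L²`
  (`ArthurClozel1989_weakLifting_cuspidal n`), multiplicity one (`multiplicity_one_gl n`), Thm. 5.1 (i)
  at the unramified places; the hypothesis at a ramified place is not needed (Thm. 4.2 (b) is a
  theorem of the tree, `ArthurClozel1989_dvd_of_twist_eq_holds`).

The general case `ℓ ∣ n` (where "unramified at a ramified place" is genuinely used, through the
Chenevier–Harris criterion `NonSelfTwistAtRamifiedPlace` and the ramification of the class-field
character) is `ArthurClozel1989_strongLifting_cuspidal.of_leaves` of
`Literature/NumberTheory/Automorphic/BaseChangeStrongCuspidalPrimeProofs`.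

## References

* J. Arthur, L. Clozel, *Simple algebras, base change, and the advanced theory of the trace formula*,
  Ann. of Math. Stud. 120 (1989), Ch. 3, Thm. 4.2 (a), (b), Thm. 5.1, §1 (1.1). [ArthurClozelAMS120]
* G. Chenevier, M. Harris, Camb. J. Math. 1 (2013), proof of Prop. 3.1.1 (p. 64). [ChenevierHarris2013]
-/

noncomputable section

-- `Summit.Langlands.Langlands.…` is the mandated summit-side namespace (CONVENTIONS §2); the summit and
-- its single problem share the name, as in the sibling modules of this crux.
set_option linter.dupNamespace false

open NumberField IsDedekindDomain MeasureTheory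
open Literature.NumberTheory.Automorphic Literature.NumberTheory.Automorphic.AdelicGroupData

namespace Summit.Langlands.Langlands.Theorems.ACStrongCuspidalBaseChangePrime

/-- **The item from the named fact** (identity): `ACStrongCuspidalBaseChangePrime` is, word for word,
`ArthurClozel1989_strongLifting_cuspidal` with `IsUnramifiedBaseChangeLift` unfolded
(`ArthurClozel1989_strongLifting_cuspidal_iff`, `Iff.rfl`).  CONDITIONAL on that XL named fact; this is
the closing term the day its discharge lands.
[cite: ArthurClozelAMS120, Ch. 3 Thm. 4.2 (a), Thm. 5.1, §1 (1.1)] -/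
theorem of_strongLifting (h : ArthurClozel1989_strongLifting_cuspidal) :
    ∀ (n : ℕ) (F E : Type) [Field F] [NumberField F] [Field E] [NumberField E] [Algebra F E]
      [IsGalois F E], (Module.finrank F E).Prime →
      ∀ (hF : Literature.NumberTheory.Automorphic.isCompact_glFiniteIntegralLevel n F)
        (π : Literature.NumberTheory.Automorphic.CuspidalAutomorphicRepData n F hF),
        (∃ v : IsDedekindDomain.HeightOneSpectrum (NumberField.RingOfIntegers F),
            ¬ Algebra.IsUnramifiedIn (NumberField.RingOfIntegers E) v.asIdeal ∧ π.1.IsUnramifiedAt v) →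
        ∀ (hE : Literature.NumberTheory.Automorphic.isCompact_glFiniteIntegralLevel n E),
          ∃ P : Literature.NumberTheory.Automorphic.CuspidalAutomorphicRepData n E hE,
            ∀ (w : IsDedekindDomain.HeightOneSpectrum (NumberField.RingOfIntegers E))
              (v : IsDedekindDomain.HeightOneSpectrum (NumberField.RingOfIntegers F)) (α : Multiset ℂ),
              w.asIdeal.under (NumberField.RingOfIntegers F) = v.asIdeal →
                Algebra.IsUnramifiedIn (NumberField.RingOfIntegers E) v.asIdeal →
                  π.1.HasSatakeParamAt v α →
                    P.1.HasSatakeParamAt w (α.map (· ^ w.asIdeal.inertiaDeg (NumberField.RingOfIntegers F))) :=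
  h

/-- **The named fact from the item** (identity), so that the item and
`ArthurClozel1989_strongLifting_cuspidal` are the same proposition: the item is exactly as hard as
Arthur–Clozel's Thm. 4.2 (a) + 5.1 for all `n`. [cite: ArthurClozelAMS120, Ch. 3 Thm. 4.2 (a), Thm. 5.1] -/
theorem strongLifting_of
    (h : ∀ (n : ℕ) (F E : Type) [Field F] [NumberField F] [Field E] [NumberField E] [Algebra F E]
      [IsGalois F E], (Module.finrank F E).Prime →
      ∀ (hF : Literature.NumberTheory.Automorphic.isCompact_glFiniteIntegralLevel n F)
        (π : Literature.NumberTheory.Automorphic.CuspidalAutomorphicRepData n F hF),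
        (∃ v : IsDedekindDomain.HeightOneSpectrum (NumberField.RingOfIntegers F),
            ¬ Algebra.IsUnramifiedIn (NumberField.RingOfIntegers E) v.asIdeal ∧ π.1.IsUnramifiedAt v) →
        ∀ (hE : Literature.NumberTheory.Automorphic.isCompact_glFiniteIntegralLevel n E),
          ∃ P : Literature.NumberTheory.Automorphic.CuspidalAutomorphicRepData n E hE,
            ∀ (w : IsDedekindDomain.HeightOneSpectrum (NumberField.RingOfIntegers E))
              (v : IsDedekindDomain.HeightOneSpectrum (NumberField.RingOfIntegers F)) (α : Multiset ℂ),
              w.asIdeal.under (NumberField.RingOfIntegers F) = v.asIdeal →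
                Algebra.IsUnramifiedIn (NumberField.RingOfIntegers E) v.asIdeal →
                  π.1.HasSatakeParamAt v α →
                    P.1.HasSatakeParamAt w (α.map (· ^ w.asIdeal.inertiaDeg (NumberField.RingOfIntegers F)))) :
    ArthurClozel1989_strongLifting_cuspidal :=
  h

/-- **Ranks `n ≤ 1` of the item, unconditionally**: the item's full binder shape with the leading
`∀ n` restricted to `n ≤ 1` (`ArthurClozel1989_strongLifting_cuspidal.of_le_one`: `GL_0` degenerate,
`GL_1` by base change of Hecke characters `χ ↦ χ ∘ N_{E/F}`, strong multiplicity one in rank one and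
Thm. 5.1 (i) in rank one, all theorems of the tree; the hypothesis at a ramified place is accepted and
not used). [cite: ArthurClozelAMS120, Ch. 3 Thm. 4.2 (a), Thm. 5.1, for n ≤ 1] -/
theorem rank_le_one :
    ∀ (n : ℕ), n ≤ 1 → ∀ (F E : Type) [Field F] [NumberField F] [Field E] [NumberField E] [Algebra F E]
      [IsGalois F E], (Module.finrank F E).Prime →
      ∀ (hF : Literature.NumberTheory.Automorphic.isCompact_glFiniteIntegralLevel n F)
        (π : Literature.NumberTheory.Automorphic.CuspidalAutomorphicRepData n F hF),
        (∃ v : IsDedekindDomain.HeightOneSpectrum (NumberField.RingOfIntegers F),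
            ¬ Algebra.IsUnramifiedIn (NumberField.RingOfIntegers E) v.asIdeal ∧ π.1.IsUnramifiedAt v) →
        ∀ (hE : Literature.NumberTheory.Automorphic.isCompact_glFiniteIntegralLevel n E),
          ∃ P : Literature.NumberTheory.Automorphic.CuspidalAutomorphicRepData n E hE,
            ∀ (w : IsDedekindDomain.HeightOneSpectrum (NumberField.RingOfIntegers E))
              (v : IsDedekindDomain.HeightOneSpectrum (NumberField.RingOfIntegers F)) (α : Multiset ℂ),
              w.asIdeal.under (NumberField.RingOfIntegers F) = v.asIdeal →
                Algebra.IsUnramifiedIn (NumberField.RingOfIntegers E) v.asIdeal →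
                  π.1.HasSatakeParamAt v α →
                    P.1.HasSatakeParamAt w (α.map (· ^ w.asIdeal.inertiaDeg (NumberField.RingOfIntegers F))) :=
  fun _ hn F E _ _ _ _ _ _ hℓ hF π hv hE =>
    ArthurClozel1989_strongLifting_cuspidal.of_le_one hn F E hℓ hF π hv hE

/-- **The item's conclusion for `ℓ = [E:F] ∤ n`, for every cuspidal `π`, from the rank-`n` leaves**:
Thm. 4.2 (a) in `L²` (`hX`), multiplicity one on `L²_cusp(GL_n)` (`hm1`) and Thm. 5.1 (i) at the
unramified places (`h51`) — `ArthurClozel1989_strongLifting_cuspidal.of_not_dvd_of_leaves`; the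
ramified-place hypothesis of the item is not needed here (Thm. 4.2 (b), `π ⊗ η = π ⇒ ℓ ∣ n`, is the
tree's theorem `ArthurClozel1989_dvd_of_twist_eq_holds`).  CONDITIONAL on the three rank-`n` leaves.
[cite: ArthurClozelAMS120, Ch. 3 Thm. 4.2 (a), (b), Thm. 5.1] -/
theorem of_not_dvd {n : ℕ}
    (hX : ∀ (F E : Type) [Field F] [NumberField F] [Field E] [NumberField E] [Algebra F E],
      ArthurClozel1989_weakLifting_cuspidal n F E)
    (hm1 : ∀ (K : Type) [Field K] [NumberField K] (μ : Measure (gl n K).automorphicQuotient)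
      [(gl n K).IsAutomorphicMeasure μ], multiplicity_one_gl n K μ)
    (h51 : ∀ (F E : Type) [Field F] [NumberField F] [Field E] [NumberField E] [Algebra F E]
      [IsGalois F E], (Module.finrank F E).Prime →
      ∀ (hF : isCompact_glFiniteIntegralLevel n F) (hE : isCompact_glFiniteIntegralLevel n E)
        (π : CuspidalAutomorphicRepData n F hF) (P : CuspidalAutomorphicRepData n E hE),
        IsWeakBaseChangeLiftAE π.1 P.1 → IsUnramifiedBaseChangeLift π.1 P.1)
    (F E : Type) [Field F] [NumberField F] [Field E] [NumberField E] [Algebra F E] [IsGalois F E]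
    (hℓ : (Module.finrank F E).Prime) (hndvd : ¬ Module.finrank F E ∣ n)
    (hF : Literature.NumberTheory.Automorphic.isCompact_glFiniteIntegralLevel n F)
    (π : Literature.NumberTheory.Automorphic.CuspidalAutomorphicRepData n F hF)
    (hE : Literature.NumberTheory.Automorphic.isCompact_glFiniteIntegralLevel n E) :
    ∃ P : Literature.NumberTheory.Automorphic.CuspidalAutomorphicRepData n E hE,
      ∀ (w : IsDedekindDomain.HeightOneSpectrum (NumberField.RingOfIntegers E))
        (v : IsDedekindDomain.HeightOneSpectrum (NumberField.RingOfIntegers F)) (α : Multiset ℂ),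
        w.asIdeal.under (NumberField.RingOfIntegers F) = v.asIdeal →
          Algebra.IsUnramifiedIn (NumberField.RingOfIntegers E) v.asIdeal →
            π.1.HasSatakeParamAt v α →
              P.1.HasSatakeParamAt w (α.map (· ^ w.asIdeal.inertiaDeg (NumberField.RingOfIntegers F))) :=
  ArthurClozel1989_strongLifting_cuspidal.of_not_dvd_of_leaves hX hm1 h51 F E hℓ hndvd hF π hE

/-- **The item from the tree's leaves (appended 2026-08-16).**  Granting, for all `n`, Thm. 4.2 (a)
in `L²` (`hX`), multiplicity one (`hm1`), the named fact `ArthurClozel1989_strongLifting_unramified`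
(Thm. 5.1 at the unramified places) and the class-field-theoretic sentence `hR` (a class-field
character of a prime-degree `E/F` is ramified at every finite place ramified in `E`: Childress,
*Class Field Theory*, Ch. 6 Thm. 3.4 with the proof of Thm. 3.7; in the tree the named fact
`localUnits_not_mem_normGroup_of_not_isUnramifiedIn` and its corollary `….not_isUnramifiedAt_of_prime`),
the item holds — `ArthurClozel1989_strongLifting_cuspidal.of_leaves`
(`Literature/NumberTheory/Automorphic/BaseChangeStrongCuspidalPrimeProofs`: rank `0` degenerate, rank
`n ≥ 1` through the Chenevier–Harris criterion of `NonSelfTwistAtRamifiedPlace` — a cuspidal `π` with a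
spherical vector at `v` is not fixed by the twist by a character ramified at `v`).  CONDITIONAL on the
four leaves; this is the item's exact residue.
[cite: ArthurClozelAMS120, Ch. 3 Thm. 4.2 (a), (b), Thm. 5.1, §1 (1.1)]
[cite: ChenevierHarris2013, proof of Prop. 3.1.1 (p. 64)] -/
theorem of_leaves
    (hX : ∀ (n : ℕ) (F E : Type) [Field F] [NumberField F] [Field E] [NumberField E] [Algebra F E],
      ArthurClozel1989_weakLifting_cuspidal n F E)
    (hm1 : ∀ (n : ℕ) (K : Type) [Field K] [NumberField K] (μ : Measure (gl n K).automorphicQuotient)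
      [(gl n K).IsAutomorphicMeasure μ], multiplicity_one_gl n K μ)
    (h51 : ArthurClozel1989_strongLifting_unramified)
    (hR : ∀ (F E : Type) [Field F] [NumberField F] [Field E] [NumberField E] [Algebra F E]
      [FiniteDimensional F E] [IsGalois F E], (Module.finrank F E).Prime →
      ∀ (η : Literature.NumberTheory.GaloisRepresentations.HeckeCharacter F), η.IsClassFieldCharacter E →
      ∀ v : IsDedekindDomain.HeightOneSpectrum (NumberField.RingOfIntegers F),
        ¬ Algebra.IsUnramifiedIn (NumberField.RingOfIntegers E) v.asIdeal → ¬ η.IsUnramifiedAt v) :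
    ∀ (n : ℕ) (F E : Type) [Field F] [NumberField F] [Field E] [NumberField E] [Algebra F E]
      [IsGalois F E], (Module.finrank F E).Prime →
      ∀ (hF : Literature.NumberTheory.Automorphic.isCompact_glFiniteIntegralLevel n F)
        (π : Literature.NumberTheory.Automorphic.CuspidalAutomorphicRepData n F hF),
        (∃ v : IsDedekindDomain.HeightOneSpectrum (NumberField.RingOfIntegers F),
            ¬ Algebra.IsUnramifiedIn (NumberField.RingOfIntegers E) v.asIdeal ∧ π.1.IsUnramifiedAt v) →
        ∀ (hE : Literature.NumberTheory.Automorphic.isCompact_glFiniteIntegralLevel n E),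
          ∃ P : Literature.NumberTheory.Automorphic.CuspidalAutomorphicRepData n E hE,
            ∀ (w : IsDedekindDomain.HeightOneSpectrum (NumberField.RingOfIntegers E))
              (v : IsDedekindDomain.HeightOneSpectrum (NumberField.RingOfIntegers F)) (α : Multiset ℂ),
              w.asIdeal.under (NumberField.RingOfIntegers F) = v.asIdeal →
                Algebra.IsUnramifiedIn (NumberField.RingOfIntegers E) v.asIdeal →
                  π.1.HasSatakeParamAt v α →
                    P.1.HasSatakeParamAt w (α.map (· ^ w.asIdeal.inertiaDeg (NumberField.RingOfIntegers F))) :=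
  ArthurClozel1989_strongLifting_cuspidal.of_leaves hX hm1 h51 hR

/-- **The item from NAMED leaves only (appended 2026-08-16)** — its exact residue by name: the XL
trace-formula leaf `ArthurClozel1989_weakLifting_cuspidal` (∀ `n`; Thm. 4.2 (a) in `L²`),
`multiplicity_one_gl` (∀ `n`), `ArthurClozel1989_strongLifting_unramified` (Thm. 5.1 at the unramified
places) and the class-field-theoretic named fact `localUnits_not_mem_normGroup_of_not_isUnramifiedIn`
(Childress, Ch. 6 Thm. 3.4 / proof of Thm. 3.7) — `ArthurClozel1989_strongLifting_cuspidal.of_namedLeaves`.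
CONDITIONAL on these four names and on nothing else.
[cite: ArthurClozelAMS120, Ch. 3 Thm. 4.2 (a), (b), Thm. 5.1, §1 (1.1)] -/
theorem of_namedLeaves
    (hX : ∀ (n : ℕ) (F E : Type) [Field F] [NumberField F] [Field E] [NumberField E] [Algebra F E],
      ArthurClozel1989_weakLifting_cuspidal n F E)
    (hm1 : ∀ (n : ℕ) (K : Type) [Field K] [NumberField K] (μ : Measure (gl n K).automorphicQuotient)
      [(gl n K).IsAutomorphicMeasure μ], multiplicity_one_gl n K μ)
    (h51 : ArthurClozel1989_strongLifting_unramified)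
    (hR : localUnits_not_mem_normGroup_of_not_isUnramifiedIn) :
    ∀ (n : ℕ) (F E : Type) [Field F] [NumberField F] [Field E] [NumberField E] [Algebra F E]
      [IsGalois F E], (Module.finrank F E).Prime →
      ∀ (hF : Literature.NumberTheory.Automorphic.isCompact_glFiniteIntegralLevel n F)
        (π : Literature.NumberTheory.Automorphic.CuspidalAutomorphicRepData n F hF),
        (∃ v : IsDedekindDomain.HeightOneSpectrum (NumberField.RingOfIntegers F),
            ¬ Algebra.IsUnramifiedIn (NumberField.RingOfIntegers E) v.asIdeal ∧ π.1.IsUnramifiedAt v) →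
        ∀ (hE : Literature.NumberTheory.Automorphic.isCompact_glFiniteIntegralLevel n E),
          ∃ P : Literature.NumberTheory.Automorphic.CuspidalAutomorphicRepData n E hE,
            ∀ (w : IsDedekindDomain.HeightOneSpectrum (NumberField.RingOfIntegers E))
              (v : IsDedekindDomain.HeightOneSpectrum (NumberField.RingOfIntegers F)) (α : Multiset ℂ),
              w.asIdeal.under (NumberField.RingOfIntegers F) = v.asIdeal →
                Algebra.IsUnramifiedIn (NumberField.RingOfIntegers E) v.asIdeal →
                  π.1.HasSatakeParamAt v α →
                    P.1.HasSatakeParamAt w (α.map (· ^ w.asIdeal.inertiaDeg (NumberField.RingOfIntegers F))) :=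
  ArthurClozel1989_strongLifting_cuspidal.of_namedLeaves hX hm1 h51 hR

end Summit.Langlands.Langlands.Theorems.ACStrongCuspidalBaseChangePrime
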